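import Summits.QuantumFields.YangMills.Theorems.BalabanUVNodesN19LawSummabilityThresholdSharp

/-!
# YM-DAG node N19 (= NE7 proper) — THE LAW-SUMMABILITY THRESHOLD, INSTANTIATED: geometric remainders NEVER meet it (N19's `Target` with the
# programme's `Cθ^K` admits laws with non-summable increments, every `C`, every `θ`), Gaussian-type remainders `≤ e^{−(K+1)²}` ALWAYS do

Cell `pub-ymgap`, HUMAN RULING D-0062 (Track A) ∕ D-0149 (work-bound push), R141 (C) wider-strategy seat `pub-ymgap-dag-n19-e` (strategy s3 =
ALTERNATIVE CURRENCY), generation g22, module 3 (lineage module 76).  Route `Summits/QuantumFields/YangMills/Theses/BalabanUVNodes.lean` rev 25,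
cluster item K3⁷ «SpineGivenEndpointR13SepCoPH» (stmt-QuantumFields-20544); filed `--supports` that item `--as helper` (it proves no registered
stub).  COUNT-NEUTRAL: [folklore] over Mathlib (`Real.posLog`, `Real.log_le_rpow_div`, `Real.summable_nat_rpow_inv`) + modules 74 ∕ 75 BY NAME
(`one_div_le_logRate`, `logRate_antitone`, `logRate_posLog_inv_mono`, `summable_lawIncrements_of_matchingModConstants`, `summable_lawIncrements_of_target`,
`exists_target_not_summable_lawIncrements`); `Spine.NE7.Target` is CONCLUDED for a TOY family (§1) resp. a HYPOTHESIS at the scheme (§2); no Theses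
import; NOT a discharge claim.

THE TWO INSTANCES of the exact threshold `Σ_K r(log⁺(vol·δ_K)⁻¹) < ∞` (modules 74 ∕ 75, `r(L) = log(e+L)∕(1+L)`):
* §1 GEOMETRIC REMAINDERS — the programme's case (node U4′: `δ_K = Cθ^K`).  `log⁺(vol·Cθ^K)⁻¹ ≤ log⁺(volC)⁻¹ + K·log⁺θ⁻¹` (`posLog_mul`, `posLog_pow`),
  so `r_K ≥ 1∕(1 + A + BK) ≥ 1∕((1+A+B)(K+1))` — harmonic: ★ `not_summable_logRate_geometric` (NO hypothesis on `vol, C, θ`).  Hence ★★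
  `exists_target_geometric_not_summable_lawIncrements`: for EVERY `l₀, vol, C > 0` and `θ ∈ (0,1)` there are probability laws `λ_K` on `[−1,1]` with
  `Spine.NE7.Target vol l₀ (K ↦ Cθ^K) (K t ↦ mgf λ_K t)` — N19's DECL target AT EXACTLY the programme's remainders — and continuous `1`-Lipschitz
  `1`-bounded tests with NON-summable increments (module 73 had this only for its own super-geometric `δ`; module 75's budget-driven levels give it
  for the prescribed `δ`); more generally ★ `not_summable_logRate_of_geometric_le` ∕ ★ `exists_target_not_summable_lawIncrements_of_geometric_le`:
  EVERY antitone summable remainder bounded BELOW by a geometric sequence fails the threshold and admits such laws.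
* §2 GAUSSIAN-TYPE REMAINDERS `vol·δ_K ≤ e^{−(K+1)²}`: `log⁺(vol·δ_K)⁻¹ ≥ (K+1)²`, `r` antitone, `log(e + (K+1)²) ≤ 2log(K+2) ≤ 8(K+2)^{1∕4}`,
  `(K+1)² ≥ (K+2)²∕4` ⇒ `r_K ≤ 32·(K+2)^{−7∕4}` — summable: ★ `summable_logRate_of_le_exp_neg_sq`.  Hence (module 74 BY NAME) ★
  `summable_lawIncrements_of_matchingModConstants_expNegSq` (laws on `[−1,1]`) and ★ `summable_lawIncrements_of_target_expNegSq` (at the scheme, under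
  N19's DECL target with such a remainder): the window currency DOES control the string laws summably once the remainders decay this fast.

HONEST FRAMING (binding).  Elementary and [folklore]; TOY laws resp. the scheme under a HYPOTHESIS; NO consumer in the DAG today (a structural
statement about the seat's own currencies); nothing of Bałaban's instantiated; NE7 NOT PRINTED, NOT proved; N19 NOT discharged; count-neutral.
One finite `T⁴` programme at fixed `ε`; nothing continuum ∕ `ℝ⁴` ∕ OS ∕ mass-gap ∕ Clay.  0 `def` ∕ 0 `sorry`.
-/

noncomputable section

open Real Filter Topology MeasureTheory ProbabilityTheory

namespace Summit.QuantumFields.YangMills.Theorems.BalabanUVNodesN19LawSummabilityThresholdExamples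

open Literature.MathematicalPhysics.QuantumFieldTheory.Balaban1983to89
open T4GenFunBounds (prodObs gibbsMeasure schemeZ)
open T4CauchySum (MatchingModConstants)
open Missing (TorusScheme)
open Summit.QuantumFields.BalabanUV.T4Continuum.Spine
open Summit.QuantumFields.YangMills.Theorems.BalabanUVNodesN19LawSummabilityThreshold
  (one_div_le_logRate logRate_pos logRate_posLog_inv_mono summable_lawIncrements_of_matchingModConstants summable_lawIncrements_of_target)
open Summit.QuantumFields.YangMills.Theorems.BalabanUVNodesN19LawSummabilityThresholdSharp (exists_target_not_summable_lawIncrements)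

/-! ## §1 Geometric remainders never meet the threshold [folklore] -/

/-- `log⁺(vol·Cθ^K)⁻¹ ≤ log⁺(volC)⁻¹ + K·log⁺θ⁻¹` (`posLog_mul`, `posLog_pow`; no sign hypotheses). [folklore] -/
theorem posLog_inv_geometric_le (vol C θ : ℝ) (K : ℕ) :
    Real.posLog (vol * (C * θ ^ K))⁻¹ ≤ Real.posLog (vol * C)⁻¹ + K * Real.posLog θ⁻¹ := by
  have e : (vol * (C * θ ^ K))⁻¹ = (vol * C)⁻¹ * (θ⁻¹) ^ K := by rw [← mul_assoc, mul_inv, inv_pow]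
  rw [e]
  calc Real.posLog ((vol * C)⁻¹ * θ⁻¹ ^ K) ≤ Real.posLog (vol * C)⁻¹ + Real.posLog (θ⁻¹ ^ K) := Real.posLog_mul
    _ = Real.posLog (vol * C)⁻¹ + K * Real.posLog θ⁻¹ := by rw [Real.posLog_pow]

/-- ★ **GEOMETRIC REMAINDERS NEVER MEET THE THRESHOLD**: `Σ_K r(log⁺(vol·Cθ^K)⁻¹) = ∞` for ALL `vol, C, θ`
(`r_K ≥ 1∕(1 + log⁺(vol·Cθ^K)⁻¹) ≥ 1∕((1 + A + B)(K+1))`, harmonic). [folklore] -/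
theorem not_summable_logRate_geometric (vol C θ : ℝ) :
    ¬ Summable fun K : ℕ =>
      Real.log (Real.exp 1 + Real.posLog (vol * (C * θ ^ K))⁻¹) / (1 + Real.posLog (vol * (C * θ ^ K))⁻¹) := by
  intro hS
  set A : ℝ := Real.posLog (vol * C)⁻¹ with hAdef
  set B : ℝ := Real.posLog θ⁻¹ with hBdef
  have hA : 0 ≤ A := Real.posLog_nonneg
  have hB : 0 ≤ B := Real.posLog_nonneg
  have hlow : ∀ K : ℕ, 1 / ((1 + A + B) * ((K : ℝ) + 1)) ≤
      Real.log (Real.exp 1 + Real.posLog (vol * (C * θ ^ K))⁻¹) / (1 + Real.posLog (vol * (C * θ ^ K))⁻¹) := fun K => by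
    have hL0 : 0 ≤ Real.posLog (vol * (C * θ ^ K))⁻¹ := Real.posLog_nonneg
    have hLK : Real.posLog (vol * (C * θ ^ K))⁻¹ ≤ A + K * B := posLog_inv_geometric_le vol C θ K
    have hK0 : (0 : ℝ) ≤ K := Nat.cast_nonneg K
    calc 1 / ((1 + A + B) * ((K : ℝ) + 1)) ≤ 1 / (1 + Real.posLog (vol * (C * θ ^ K))⁻¹) :=
          one_div_le_one_div_of_le (by linarith) (by nlinarith)
      _ ≤ _ := one_div_le_logRate hL0
  have h1 : Summable (fun K : ℕ => 1 / ((1 + A + B) * ((K : ℝ) + 1))) :=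
    Summable.of_nonneg_of_le (fun K => by positivity) hlow hS
  have h2 : Summable (fun K : ℕ => 1 / ((K + 1 : ℕ) : ℝ)) := by
    refine (h1.mul_left (1 + A + B)).congr fun K => ?_
    have hK1 : (0 : ℝ) < (K : ℝ) + 1 := by positivity
    push_cast
    field_simp
  exact Real.not_summable_one_div_natCast ((summable_nat_add_iff 1).1 h2)

/-- ★★ **N19's DECL TARGET AT THE PROGRAMME'S GEOMETRIC REMAINDERS DOES NOT CONTROL THE LAWS SUMMABLY.**  For every `l₀, vol, C > 0` and
`θ ∈ (0,1)` there are probability laws `λ_K` on `[−1,1]` with `Spine.NE7.Target vol l₀ (K ↦ Cθ^K) (K t ↦ mgf λ_K t)` and continuous tests `g_K`,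
`1`-Lipschitz and `1`-bounded on `[−1,1]`, whose increments `|∫g_K dλ_{K+1} − ∫g_K dλ_K|` are NOT summable (module 75 at `δ_K = Cθ^K`). [folklore] -/
theorem exists_target_geometric_not_summable_lawIncrements {l₀ vol C θ : ℝ} (hl₀ : 0 < l₀) (hvol : 0 < vol) (hC : 0 < C)
    (hθ : 0 < θ) (hθ1 : θ < 1) :
    ∃ Λ : ℕ → Measure ℝ, (∀ K, IsProbabilityMeasure (Λ K)) ∧ (∀ K, Λ K (Set.Icc (-1 : ℝ) 1)ᶜ = 0) ∧
      NE7.Target vol l₀ (fun K => C * θ ^ K) (fun K t => mgf id (Λ K) t) ∧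
      ∃ g : ℕ → ℝ → ℝ, (∀ K, Continuous (g K)) ∧
        (∀ (K : ℕ) (x y : ℝ), x ∈ Set.Icc (-1 : ℝ) 1 → y ∈ Set.Icc (-1 : ℝ) 1 → |g K x - g K y| ≤ 1 * |x - y|) ∧
        (∀ (K : ℕ) (x : ℝ), x ∈ Set.Icc (-1 : ℝ) 1 → |g K x| ≤ 1) ∧
        ¬ Summable (fun K => |∫ x, g K x ∂Λ (K + 1) - ∫ x, g K x ∂Λ K|) :=
  exists_target_not_summable_lawIncrements hl₀ hvol (fun K => by positivity)
    (fun a b hab => mul_le_mul_of_nonneg_left (pow_le_pow_of_le_one hθ.le hθ1.le hab) hC.le)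
    ((summable_geometric_of_lt_one hθ.le hθ1).mul_left C) (not_summable_logRate_geometric vol C θ)

/-- ★ **NOR DOES ANY REMAINDER DECAYING AT MOST GEOMETRICALLY**: `Cθ^K ≤ δ_K` for all `K` (`C, θ, vol > 0`) ⇒ `Σ_K r(log⁺(vol·δ_K)⁻¹) = ∞`
(the rate is monotone in the budget). [folklore] -/
theorem not_summable_logRate_of_geometric_le {vol C θ : ℝ} {δ : ℕ → ℝ} (hvol : 0 < vol) (hC : 0 < C) (hθ : 0 < θ)
    (hle : ∀ K : ℕ, C * θ ^ K ≤ δ K) :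
    ¬ Summable fun K : ℕ => Real.log (Real.exp 1 + Real.posLog (vol * δ K)⁻¹) / (1 + Real.posLog (vol * δ K)⁻¹) := fun hS =>
  not_summable_logRate_geometric vol C θ
    (Summable.of_nonneg_of_le (fun K => (logRate_pos Real.posLog_nonneg).le)
      (fun K => logRate_posLog_inv_mono (by positivity : 0 < vol * (C * θ ^ K)) (mul_le_mul_of_nonneg_left (hle K) hvol.le)) hS)

/-- ★ **… SO N19's DECL TARGET WITH ANY ANTITONE SUMMABLE REMAINDER BOUNDED BELOW GEOMETRICALLY admits laws with non-summable increments**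
(module 75 BY NAME). [folklore] -/
theorem exists_target_not_summable_lawIncrements_of_geometric_le {l₀ vol C θ : ℝ} {δ : ℕ → ℝ} (hl₀ : 0 < l₀) (hvol : 0 < vol)
    (hC : 0 < C) (hθ : 0 < θ) (hle : ∀ K : ℕ, C * θ ^ K ≤ δ K) (hanti : Antitone δ) (hsum : Summable δ) :
    ∃ Λ : ℕ → Measure ℝ, (∀ K, IsProbabilityMeasure (Λ K)) ∧ (∀ K, Λ K (Set.Icc (-1 : ℝ) 1)ᶜ = 0) ∧
      NE7.Target vol l₀ δ (fun K t => mgf id (Λ K) t) ∧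
      ∃ g : ℕ → ℝ → ℝ, (∀ K, Continuous (g K)) ∧
        (∀ (K : ℕ) (x y : ℝ), x ∈ Set.Icc (-1 : ℝ) 1 → y ∈ Set.Icc (-1 : ℝ) 1 → |g K x - g K y| ≤ 1 * |x - y|) ∧
        (∀ (K : ℕ) (x : ℝ), x ∈ Set.Icc (-1 : ℝ) 1 → |g K x| ≤ 1) ∧
        ¬ Summable (fun K => |∫ x, g K x ∂Λ (K + 1) - ∫ x, g K x ∂Λ K|) :=
  exists_target_not_summable_lawIncrements hl₀ hvol (fun K => lt_of_lt_of_le (by positivity) (hle K)) hanti hsum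
    (not_summable_logRate_of_geometric_le hvol hC hθ hle)

/-! ## §2 Gaussian-type remainders always meet the threshold [folklore] -/

/-- The rate at `L = (K+1)²`: `r((K+1)²) ≤ 32·(K+2)^{−7∕4}` (`e + (K+1)² ≤ (K+2)²`, `log(K+2) ≤ 4(K+2)^{1∕4}`, `(K+2)² ≤ 4(K+1)²`). [folklore] -/
theorem logRate_sq_le (K : ℕ) :
    Real.log (Real.exp 1 + ((K : ℝ) + 1) ^ 2) / (1 + ((K : ℝ) + 1) ^ 2) ≤ 32 * (((K : ℝ) + 2) ^ (7 / 4 : ℝ))⁻¹ := by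
  have hK : (0 : ℝ) ≤ K := Nat.cast_nonneg K
  have hx : (0 : ℝ) < (K : ℝ) + 2 := by positivity
  have he : Real.exp 1 < 2.7182818286 := Real.exp_one_lt_d9
  -- numerator: `log(e + (K+1)²) ≤ log((K+2)²) = 2 log(K+2) ≤ 8 (K+2)^{1/4}`
  have h1 : Real.log (Real.exp 1 + ((K : ℝ) + 1) ^ 2) ≤ 2 * Real.log ((K : ℝ) + 2) := by
    rw [show (2 : ℝ) * Real.log ((K : ℝ) + 2) = Real.log (((K : ℝ) + 2) ^ 2) by rw [Real.log_pow]; norm_num]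
    exact Real.log_le_log (by positivity) (by nlinarith)
  have h2 : Real.log ((K : ℝ) + 2) ≤ ((K : ℝ) + 2) ^ (1 / 4 : ℝ) / (1 / 4) := Real.log_le_rpow_div hx.le (by norm_num)
  have hnum : Real.log (Real.exp 1 + ((K : ℝ) + 1) ^ 2) ≤ 8 * ((K : ℝ) + 2) ^ (1 / 4 : ℝ) := by linarith
  -- denominator: `1 + (K+1)² ≥ (K+2)²/4`
  have hden : ((K : ℝ) + 2) ^ (2 : ℝ) / 4 ≤ 1 + ((K : ℝ) + 1) ^ 2 := by
    rw [Real.rpow_two]; nlinarith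
  have hden0 : 0 < ((K : ℝ) + 2) ^ (2 : ℝ) / 4 := by positivity
  calc Real.log (Real.exp 1 + ((K : ℝ) + 1) ^ 2) / (1 + ((K : ℝ) + 1) ^ 2)
      ≤ 8 * ((K : ℝ) + 2) ^ (1 / 4 : ℝ) / (((K : ℝ) + 2) ^ (2 : ℝ) / 4) :=
        div_le_div₀ (by positivity) hnum hden0 hden
    _ = 32 * (((K : ℝ) + 2) ^ (1 / 4 : ℝ) / ((K : ℝ) + 2) ^ (2 : ℝ)) := by ring
    _ = 32 * (((K : ℝ) + 2) ^ (7 / 4 : ℝ))⁻¹ := by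
        rw [← Real.rpow_sub hx, show (1 / 4 : ℝ) - 2 = -(7 / 4) by norm_num, Real.rpow_neg hx.le]

/-- ★ **GAUSSIAN-TYPE REMAINDERS MEET THE THRESHOLD**: if `0 < vol·δ_K ≤ e^{−(K+1)²}` for all `K` then `Σ_K r(log⁺(vol·δ_K)⁻¹) < ∞`
(`log⁺(vol·δ_K)⁻¹ ≥ (K+1)²`, `r` monotone in the budget, `r((K+1)²) ≤ 32(K+2)^{−7∕4}`). [folklore] -/
theorem summable_logRate_of_le_exp_neg_sq {vol : ℝ} {δ : ℕ → ℝ} (hpos : ∀ K, 0 < vol * δ K)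
    (hle : ∀ K : ℕ, vol * δ K ≤ Real.exp (-(((K : ℝ) + 1) ^ 2))) :
    Summable fun K => Real.log (Real.exp 1 + Real.posLog (vol * δ K)⁻¹) / (1 + Real.posLog (vol * δ K)⁻¹) := by
  have hmaj : Summable (fun K : ℕ => 32 * (((K : ℝ) + 2) ^ (7 / 4 : ℝ))⁻¹) := by
    have h := (Real.summable_nat_rpow_inv.2 (by norm_num : (1 : ℝ) < 7 / 4)).comp_injective (add_left_injective 2)
    refine (h.congr fun K => ?_).mul_left 32
    simp only [Function.comp_apply]
    push_cast
    rfl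
  refine Summable.of_nonneg_of_le (fun K => ?_) (fun K => ?_) hmaj
  · exact div_nonneg (Real.log_nonneg (by linarith [Real.add_one_le_exp (1 : ℝ), (Real.posLog_nonneg : 0 ≤ Real.posLog (vol * δ K)⁻¹)]))
      (by linarith [(Real.posLog_nonneg : 0 ≤ Real.posLog (vol * δ K)⁻¹)])
  · -- `r(log⁺(vol δ_K)⁻¹) ≤ r(log⁺ (e^{(K+1)²})) = r((K+1)²) ≤ 32 (K+2)^{-7/4}`
    have h1 := logRate_posLog_inv_mono (hpos K) (hle K)
    have hL : Real.posLog (Real.exp (-(((K : ℝ) + 1) ^ 2)))⁻¹ = ((K : ℝ) + 1) ^ 2 := by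
      rw [← Real.exp_neg, neg_neg, Real.posLog_eq_log (by rw [abs_of_pos (Real.exp_pos _)]; exact Real.one_le_exp (by positivity)),
        Real.log_exp]
    rw [hL] at h1
    exact h1.trans (logRate_sq_le K)

/-- ★ **… HENCE SUMMABLE LAW INCREMENTS** (laws on `[−1,1]`, module 74 BY NAME): probability laws `λ_K` on `[−1,1]` with
`MatchingModConstants vol l₀ δ (K t ↦ mgf λ_K t)`, `0 < vol·δ_K ≤ e^{−(K+1)²}`, have summable increments along every test sequence uniformly
`K_g`-Lipschitz and `G_g`-bounded on `[−1,1]`. [folklore] -/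
theorem summable_lawIncrements_of_matchingModConstants_expNegSq {Λ : ℕ → Measure ℝ} [hP : ∀ K, IsProbabilityMeasure (Λ K)]
    (hΛ : ∀ K, Λ K (Set.Icc (-1 : ℝ) 1)ᶜ = 0) {vol l₀ : ℝ} (hl₀ : 0 < l₀) {δ : ℕ → ℝ} (hpos : ∀ K, 0 < vol * δ K)
    (hle : ∀ K : ℕ, vol * δ K ≤ Real.exp (-(((K : ℝ) + 1) ^ 2)))
    (hM : MatchingModConstants vol l₀ δ (fun K t => mgf id (Λ K) t))
    {g : ℕ → ℝ → ℝ} {Kg G : ℝ} (hK0 : 0 ≤ Kg)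
    (hK : ∀ (K : ℕ) (x y : ℝ), x ∈ Set.Icc (-1 : ℝ) 1 → y ∈ Set.Icc (-1 : ℝ) 1 → |g K x - g K y| ≤ Kg * |x - y|)
    (hG : ∀ (K : ℕ) (x : ℝ), x ∈ Set.Icc (-1 : ℝ) 1 → |g K x| ≤ G) :
    Summable fun K => |∫ x, g K x ∂Λ (K + 1) - ∫ x, g K x ∂Λ K| :=
  summable_lawIncrements_of_matchingModConstants hΛ hl₀ hM (summable_logRate_of_le_exp_neg_sq hpos hle) hK0 hK hG

section Scheme

variable {G : Type*} [GaugeGroup G] [MeasurableSpace G] [RegularGaugeGroup G] [HaarData G] {O : Type*}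
  (S : TorusScheme G O) (hβ : ∀ K, 0 ≤ S.β K) (hm : ∀ K o, Measurable (S.obs K o)) (h1 : ∀ K o U, |S.obs K o U| ≤ 1)
include hβ hm h1

/-- ★ **… AND AT THE SCHEME** (module 74 BY NAME): under N19's DECL target `Spine.NE7.Target vol l₀ δ (schemeZ S os)` with a Gaussian-type remainder
`0 < vol·δ_K ≤ e^{−(K+1)²}`, the expectations `K ↦ ∫g_K(∏os) dgibbs_K` have summable increments along every sequence of continuous tests uniformly
`K_g`-Lipschitz and `G_g`-bounded on `[−1,1]`.  A HYPOTHESIS on the scheme; nothing of Bałaban's instantiated. [bookkeeping] -/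
theorem summable_lawIncrements_of_target_expNegSq {vol l₀ : ℝ} (hl₀ : 0 < l₀) {δ : ℕ → ℝ} (os : List O)
    (hT : NE7.Target vol l₀ δ (schemeZ S os)) (hpos : ∀ K, 0 < vol * δ K)
    (hle : ∀ K : ℕ, vol * δ K ≤ Real.exp (-(((K : ℝ) + 1) ^ 2)))
    {g : ℕ → ℝ → ℝ} (hg : ∀ K, Continuous (g K)) {Kg Gg : ℝ} (hK0 : 0 ≤ Kg)
    (hK : ∀ (K : ℕ) (x y : ℝ), x ∈ Set.Icc (-1 : ℝ) 1 → y ∈ Set.Icc (-1 : ℝ) 1 → |g K x - g K y| ≤ Kg * |x - y|)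
    (hG : ∀ (K : ℕ) (x : ℝ), x ∈ Set.Icc (-1 : ℝ) 1 → |g K x| ≤ Gg) :
    Summable fun K => |∫ U, g K (prodObs S (K + 1) os U) ∂gibbsMeasure (S.P (K + 1)) (S.β (K + 1)) -
      ∫ U, g K (prodObs S K os U) ∂gibbsMeasure (S.P K) (S.β K)| :=
  summable_lawIncrements_of_target S hβ hm h1 hl₀ os hT (summable_logRate_of_le_exp_neg_sq hpos hle) hg hK0 hK hG

end Scheme

end Summit.QuantumFields.YangMills.Theorems.BalabanUVNodesN19LawSummabilityThresholdExamples

end
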